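import Summits.BirchSwinnertonDyer.BirchSwinnertonDyer.Theorems.PrintCf2SplitBadTwoLineSignModuleCocycle
import Summits.BirchSwinnertonDyer.BirchSwinnertonDyer.Theorems.PrintCf2SplitBadTwoLineLocalGroupAtRamified
import HarnessLib

/-!
# Road α, crux `PrintCf2.SplitBadTwoRankOneOfFacts` (stmt-BirchSwinnertonDyer-20368), stub S3d — the LOCAL DEFECT `Def(w)` at a place RAMIFIED in a `ℤ_p`-line
# for a sign module with an INERTIAL mover has AT MOST TWO ELEMENTS (class (i) of the v̄-analysis: road α `d ≡ 2, 10 (mod 16)`)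

Cell `bsd-print-cf2`, width seat `bsd-line-cf2-p1-w6` g4 (S3d: «𝓗 local + ch(𝓗^∨)(0) per class», LEAD 02:30:44Z); `--supports stmt-BirchSwinnertonDyer-20368
--as helper`. HONEST FRAMING: nothing here closes the crux or a registered stub; no summit statement is proved by this seat; BSD is not proved by any of this.
No definition, no named fact, no `sorry`.

Local object (seat currency, STATUS 02:5xZ): `Def(κ, M, w) := ker (res : H¹(ker κ ⊓ D_w, M) → H¹(ker κ ⊓ I_w, M))`, the unramified local classes over the line at the
chosen place above `w`. When `ker κ` acts on `M` by signs and SOME ELEMENT OF `ker κ ⊓ I_w` ACTS AS `−1` (an inertial mover), the invariants are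
`M^{ker κ ⊓ I_w} = M[2]` and `Def(w) = Hom_cont((ker κ ⊓ D_w)/(ker κ ⊓ I_w), M[2])`, of order `≤ 2` when `M[2]` has one non-zero element: this file proves
* `two_nsmul_eq_zero_of_inertial_mover` — for a cocycle `f` on `ker κ ⊓ D_w` principal on `ker κ ⊓ I_w` (`f = ∂m₀` there), `w := f − ∂m₀` is `2`-torsion valued
  (`w(τ₀ g) = −w(g)` and `= w(g)` by normality of inertia);
* **`eq_of_mem_localDefect_of_ne_zero`** — any two NON-ZERO elements of `Def(w)` are EQUAL (the associated continuous homomorphisms `H_F → M[2]` kill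
  `H_F ⊓ I_F` and have index-`2` open kernels, which coincide by (U′) `eq_of_isOpen_of_index_two`, p687207; values agree since `M[2] = {0, t}`); hence
  **`natCard_localDefect_le_two`**, **`finite_localDefect_of_inertial_mover`**: `Def(w)` is finite with `#Def(w) ≤ 2`.
Frame instantiation (`d ≡ 2, 10 (mod 16)`: the inertial mover with `ε = −1` of B15 file 11) is the next file; there `𝓗` is finite and `e_δ = 0`.

presearch: Greenberg LNM 1716 §3; Rubin LNM 1716 §3 Lemma 3.6 (ii); Serre Galois Cohomology I §2.4 — held; no new fact. beyond-print theorem: no.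

References: [GreenbergLNM1716] §3; [Rubin1999] §3 Lemma 3.6 (ii); [SerreGaloisCohomology1997] I §2.4, II §5.1; [Agboola2007] §3 Prop. 3.2.
-/

set_option autoImplicit false
set_option linter.dupNamespace false

noncomputable section

open scoped Classical
open NumberField IsDedekindDomain Field Multiplicative
open Literature.NumberTheory.EllipticCurves Literature.NumberTheory.EllipticCurves.GreenbergSelmer
open Literature.NumberTheory.GaloisRepresentations Literature.AnabelianGeometry.AbsoluteAnabelian

namespace Summit.BirchSwinnertonDyer.BirchSwinnertonDyer.Theorems.PrintCf2.LineLocallyTrivial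

variable {K : Type} [Field K] [NumberField K] {p : ℕ} [Fact p.Prime] (κ : ZpExtension K p)
  {M : Type} [AddCommGroup M] [DistribMulAction (absoluteGaloisGroup K) M] [TopologicalSpace M] [DiscreteTopology M]

/-- **Two non-zero unramified local classes coincide, for a sign module with an INERTIAL mover.** `κ` a `ℤ_p`-line ramified at `w`, `M` discrete with open
stabilisers and exactly one element of order `2`, `ker κ` acting on `M` by signs, `τ₀ ∈ ker κ ⊓ I_w` acting as `−1`. Then any two non-zero classes of
`H¹(ker κ ⊓ D_w, M)` that die on `ker κ ⊓ I_w` are EQUAL — so `Def(w) ≅ 0` or `ℤ/2`.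
[cite: GreenbergLNM1716, §3] [cite: Rubin1999, §3 Lemma 3.6 (ii)] [cite: SerreGaloisCohomology1997, I §2.4] -/
theorem eq_of_mem_localDefect_of_ne_zero {w : HeightOneSpectrum (𝓞 K)} (hram : ¬ GreenbergSelmer.inertia w ≤ κ.kerSubgroup)
    (hstab : ∀ m : M, IsOpen (MulAction.stabilizer (absoluteGaloisGroup K) m : Set (absoluteGaloisGroup K)))
    (hpm : ∀ g ∈ κ.kerSubgroup, (∀ m : M, g • m = m) ∨ (∀ m : M, g • m = -m))
    {τ₀ : absoluteGaloisGroup K} (hτI : τ₀ ∈ GreenbergSelmer.inertia w) (hτκ : τ₀ ∈ κ.kerSubgroup) (hτ₀ : ∀ m : M, τ₀ • m = -m)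
    (h2 : ∀ x y : M, (2 : ℕ) • x = 0 → (2 : ℕ) • y = 0 → x ≠ 0 → y ≠ 0 → x = y)
    {z z' : subgroupH1 (κ.kerSubgroup ⊓ GreenbergSelmer.decomp w) M}
    (hz : resOfLe M (inf_le_inf_left κ.kerSubgroup (GreenbergSelmer.inertia_le_decomp w)) z = 0)
    (hz' : resOfLe M (inf_le_inf_left κ.kerSubgroup (GreenbergSelmer.inertia_le_decomp w)) z' = 0)
    (hz0 : z ≠ 0) (hz'0 : z' ≠ 0) : z = z' := by
  haveI : CompactSpace (absoluteGaloisGroup (w.adicCompletion K)) := absoluteGaloisGroup_compactSpace (w.adicCompletion K)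
  set res := absGaloisRestrict K (w.adicCompletion K) with hres
  set HF : Subgroup (absoluteGaloisGroup (w.adicCompletion K)) := κ.kerSubgroup.comap res.toMonoidHom with hHF
  have hmemHF : ∀ s, s ∈ HF ↔ res s ∈ κ.kerSubgroup := fun _ ↦ Iff.rfl
  have hHFcl : IsClosed ((HF : Subgroup (absoluteGaloisGroup (w.adicCompletion K))) : Set (absoluteGaloisGroup (w.adicCompletion K))) :=
    κ.isClosed_kerSubgroup.preimage res.continuous
  let N : Subgroup HF := (galUnr (w.adicCompletion K)).subgroupOf HF
  haveI : N.Normal := (normal_galUnr (w.adicCompletion K)).subgroupOf HF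
  have hresI : ∀ n : HF, n ∈ N → res (n : absoluteGaloisGroup (w.adicCompletion K)) ∈ GreenbergSelmer.inertia w := by
    intro n hn
    have hn' : (n : absoluteGaloisGroup (w.adicCompletion K)) ∈ absInertia (w.adicCompletion K) := by
      rw [← galUnr_eq_absInertia]; exact Subgroup.mem_subgroupOf.mp hn
    exact ⟨n, hn', rfl⟩
  have hU : ∀ U₁ U₂ : Subgroup HF, IsOpen (U₁ : Set HF) → IsOpen (U₂ : Set HF) → N ≤ U₁ → N ≤ U₂ → U₁.index = 2 → U₂.index = 2 → U₁ = U₂ :=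
    fun U₁ U₂ h₁ h₂ hn₁ hn₂ hi₁ hi₂ ↦
      eq_of_isOpen_of_index_two w HF hHFcl (isOpen_comap_kerSubgroup_sup_galUnr w κ hram) U₁ U₂ h₁ h₂ hn₁ hn₂ hi₁ hi₂
  -- the inertial mover, lifted to `N`
  obtain ⟨i₀, hi₀I, hi₀⟩ := Subgroup.mem_map.mp hτI
  have hi₀' : res i₀ = τ₀ := hi₀
  have hi₀H : i₀ ∈ HF := by rw [hmemHF, hi₀']; exact hτκ
  have hi₀N : (⟨i₀, hi₀H⟩ : HF) ∈ N := Subgroup.mem_subgroupOf.mpr (by rw [galUnr_eq_absInertia]; exact hi₀I)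
  -- the surjection `φ : H_F → ker κ ⊓ D_w`
  let φ : HF →ₜ* ↥(κ.kerSubgroup ⊓ GreenbergSelmer.decomp w) :=
    ⟨{ toFun := fun s ↦ ⟨res (s : absoluteGaloisGroup (w.adicCompletion K)),
          Subgroup.mem_inf.mpr ⟨s.2, (GreenbergSelmer.mem_decomp_iff w _).mpr ⟨s, rfl⟩⟩⟩
       map_one' := Subtype.ext (map_one res)
       map_mul' := fun s t ↦ Subtype.ext (map_mul res (s : absoluteGaloisGroup (w.adicCompletion K)) t) },
      (res.continuous.comp continuous_subtype_val).subtype_mk _⟩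
  have hφ : ∀ s : HF, ((φ s : ↥(κ.kerSubgroup ⊓ GreenbergSelmer.decomp w)) : absoluteGaloisGroup K) = res s := fun _ ↦ rfl
  have hφsurj : ∀ x : ↥(κ.kerSubgroup ⊓ GreenbergSelmer.decomp w), ∃ s : HF, φ s = x := by
    intro x
    obtain ⟨τ, hτ⟩ := (GreenbergSelmer.mem_decomp_iff w _).mp (Subgroup.mem_inf.mp x.2).2
    have hτH : τ ∈ HF := by rw [hmemHF, hτ]; exact (Subgroup.mem_inf.mp x.2).1
    exact ⟨⟨τ, hτH⟩, Subtype.ext hτ⟩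
  -- orbit maps are continuous
  have hdisc : (inferInstance : TopologicalSpace M) = ⊥ := DiscreteTopology.eq_bot
  have horb : ∀ m : M, Continuous fun g : absoluteGaloisGroup K ↦ g • m := fun m ↦ by
    have h := continuous_smul_const_of_isOpen_stabilizer hstab m
    rwa [← hdisc] at h
  -- THE INVARIANT: for a class dying on inertia, `wf := f ∘ φ − ∂m₀` is a continuous `2`-torsion-valued homomorphism on `H_F` killing `N`
  have key : ∀ (f : contOneCocycles (discreteTopRep ↥(κ.kerSubgroup ⊓ GreenbergSelmer.decomp w) M)) (m₀ : M),
      (∀ x : ↥(κ.kerSubgroup ⊓ GreenbergSelmer.inertia w),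
        f.1 (Subgroup.inclusion (inf_le_inf_left κ.kerSubgroup (GreenbergSelmer.inertia_le_decomp w)) x) = (x : absoluteGaloisGroup K) • m₀ - m₀) →
      ∃ wf : HF → M, (∀ s, wf s = f.1 (φ s) - (res (s : absoluteGaloisGroup (w.adicCompletion K)) • m₀ - m₀)) ∧ Continuous wf ∧
        (∀ s t, wf (s * t) = wf s + wf t) ∧ (∀ s, (2 : ℕ) • wf s = 0) ∧ (∀ n ∈ N, wf n = 0) := by
    intro f m₀ hm₀
    refine ⟨fun s ↦ f.1 (φ s) - (res (s : absoluteGaloisGroup (w.adicCompletion K)) • m₀ - m₀), fun _ ↦ rfl, ?_, ?_⟩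
    · exact (f.1.continuous.comp φ.continuous).sub (((horb m₀).comp (res.continuous.comp continuous_subtype_val)).sub continuous_const)
    set wf : HF → M := fun s ↦ f.1 (φ s) - (res (s : absoluteGaloisGroup (w.adicCompletion K)) • m₀ - m₀) with hwf
    have hcoc : ∀ s t : HF, wf (s * t) = wf s + res (s : absoluteGaloisGroup (w.adicCompletion K)) • wf t := by
      intro s t
      have h' : f.1 (φ (s * t)) = f.1 (φ s) + res (s : absoluteGaloisGroup (w.adicCompletion K)) • f.1 (φ t) := by
        rw [map_mul]; exact f.2 (φ s) (φ t)
      simp only [hwf]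
      rw [h', Subgroup.coe_mul, map_mul, mul_smul, smul_sub, smul_sub]
      abel
    have hwN : ∀ n ∈ N, wf n = 0 := by
      intro n hn
      let x : ↥(κ.kerSubgroup ⊓ GreenbergSelmer.inertia w) :=
        ⟨res (n : absoluteGaloisGroup (w.adicCompletion K)), Subgroup.mem_inf.mpr ⟨n.2, hresI n hn⟩⟩
      have h := hm₀ x
      have hincl : Subgroup.inclusion (inf_le_inf_left κ.kerSubgroup (GreenbergSelmer.inertia_le_decomp w)) x = φ n := Subtype.ext rfl
      rw [hincl] at h
      simp only [hwf, h]
      exact sub_self _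
    -- `2 • wf s = 0`: compare `wf (i₀ s)` computed two ways
    have htwo : ∀ s : HF, (2 : ℕ) • wf s = 0 := by
      intro s
      have h1 : wf (⟨i₀, hi₀H⟩ * s) = -wf s := by
        rw [hcoc, hwN _ hi₀N, zero_add]
        change res i₀ • wf s = -wf s
        rw [hi₀', hτ₀]
      have hn' : s⁻¹ * ⟨i₀, hi₀H⟩ * s ∈ N := by
        have := (inferInstance : N.Normal).conj_mem _ hi₀N s⁻¹
        rwa [inv_inv] at this
      have h2' : wf (⟨i₀, hi₀H⟩ * s) = wf s := by
        have e : (⟨i₀, hi₀H⟩ : HF) * s = s * (s⁻¹ * ⟨i₀, hi₀H⟩ * s) := by group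
        rw [e, hcoc, hwN _ hn', smul_zero, add_zero]
      rw [two_nsmul]
      have : wf s = -wf s := h2'.symm.trans h1
      exact add_eq_zero_iff_eq_neg.mpr this
    refine ⟨fun s t ↦ ?_, htwo, hwN⟩
    rw [hcoc]
    congr 1
    rcases hpm _ s.2 with h | h
    · exact h (wf t)
    · rw [show res (s : absoluteGaloisGroup (w.adicCompletion K)) • wf t = -wf t from h (wf t), neg_eq_iff_add_eq_zero, ← two_nsmul, htwo]
  -- representatives
  obtain ⟨f, rfl⟩ := oneCocycleClass_surjective _ z
  obtain ⟨f', rfl⟩ := oneCocycleClass_surjective _ z'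
  rw [CocycleCriteria.resOfLe_oneCocycleClass_eq_zero_iff] at hz hz'
  obtain ⟨m₀, hm₀⟩ := hz
  obtain ⟨m₀', hm₀'⟩ := hz'
  obtain ⟨wf, hwf, hwfc, hwfadd, hwf2, hwfN⟩ := key f m₀ hm₀
  obtain ⟨wf', hwf', hwf'c, hwf'add, hwf'2, hwf'N⟩ := key f' m₀' hm₀'
  -- a class is zero iff its invariant vanishes identically
  have hzero : ∀ (g : contOneCocycles (discreteTopRep ↥(κ.kerSubgroup ⊓ GreenbergSelmer.decomp w) M)) (m : M) (wg : HF → M),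
      (∀ s, wg s = g.1 (φ s) - (res (s : absoluteGaloisGroup (w.adicCompletion K)) • m - m)) → (∀ s, wg s = 0) →
        oneCocycleClass _ g = 0 := by
    intro g m wg hwg hwg0
    rw [oneCocycleClass_eq_zero_iff]
    refine ⟨m, fun x ↦ ?_⟩
    obtain ⟨s, rfl⟩ := hφsurj x
    have h := hwg0 s
    rw [hwg, sub_eq_zero] at h
    exact h
  -- the kernels are open index-2 subgroups containing `N`
  have hsub : ∀ (wg : HF → M), Continuous wg → (∀ s t, wg (s * t) = wg s + wg t) → (∀ s, (2 : ℕ) • wg s = 0) → (∀ n ∈ N, wg n = 0) →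
      (∃ s, wg s ≠ 0) → ∃ U : Subgroup HF, IsOpen (U : Set HF) ∧ N ≤ U ∧ U.index = 2 ∧ ∀ s, s ∈ U ↔ wg s = 0 := by
    intro wg hc hadd h2' hN ⟨g₁, hg₁⟩
    have h1 : wg 1 = 0 := by
      have h := hadd 1 1
      rw [mul_one] at h
      exact left_eq_add.mp h
    let U : Subgroup HF :=
      { carrier := {s | wg s = 0}
        one_mem' := h1
        mul_mem' := fun {a b} ha hb ↦ by
          simp only [Set.mem_setOf_eq] at ha hb ⊢
          rw [hadd, ha, hb, add_zero]
        inv_mem' := fun {a} ha ↦ by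
          simp only [Set.mem_setOf_eq] at ha ⊢
          have h := hadd a⁻¹ a
          rw [inv_mul_cancel, h1, ha, add_zero] at h
          exact h.symm }
    have hUmem : ∀ s, s ∈ U ↔ wg s = 0 := fun _ ↦ Iff.rfl
    refine ⟨U, hc.isOpen_preimage {0} (isOpen_discrete _), fun n hn ↦ (hUmem n).mpr (hN n hn), ?_, hUmem⟩
    rw [Subgroup.index_eq_two_iff]
    refine ⟨g₁, fun b ↦ ?_⟩
    rw [hUmem, hUmem, hadd]
    by_cases hb : wg b = 0
    · rw [hb, zero_add]
      exact Or.inr ⟨rfl, hg₁⟩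
    · refine Or.inl ⟨?_, hb⟩
      rw [h2 (wg b) (wg g₁) (h2' b) (h2' g₁) hb hg₁, ← two_nsmul, h2']
  -- both invariants are non-zero somewhere
  have hne : ∃ s, wf s ≠ 0 := by
    by_contra h
    push Not at h
    exact hz0 (hzero f m₀ wf hwf h)
  have hne' : ∃ s, wf' s ≠ 0 := by
    by_contra h
    push Not at h
    exact hz'0 (hzero f' m₀' wf' hwf' h)
  obtain ⟨U, hUo, hNU, hUi, hUmem⟩ := hsub wf hwfc hwfadd hwf2 hwfN hne
  obtain ⟨U', hU'o, hNU', hU'i, hU'mem⟩ := hsub wf' hwf'c hwf'add hwf'2 hwf'N hne'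
  have hUU' : U = U' := hU U U' hUo hU'o hNU hNU' hUi hU'i
  -- hence the invariants agree pointwise
  have heq : ∀ s, wf s = wf' s := by
    intro s
    by_cases hs : wf s = 0
    · have hs' : wf' s = 0 := (hU'mem s).mp (hUU' ▸ (hUmem s).mpr hs)
      rw [hs, hs']
    · have hs' : wf' s ≠ 0 := fun h ↦ hs ((hUmem s).mp (hUU'.symm ▸ (hU'mem s).mpr h))
      exact h2 _ _ (hwf2 s) (hwf'2 s) hs hs'
  -- and the classes agree: `f − f'` is principal with `m₀ − m₀'`
  rw [← sub_eq_zero, ← oneCocycleClass_sub]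
  refine hzero (f - f') (m₀ - m₀') (fun s ↦ wf s - wf' s) (fun s ↦ ?_) (fun s ↦ sub_eq_zero.mpr (heq s))
  rw [hwf, hwf']
  change _ = (f.1 (φ s) - f'.1 (φ s)) - _
  rw [smul_sub]
  abel

/-- **`Def(w)` is FINITE with at most two elements** for a sign module with an inertial mover (hypotheses of `eq_of_mem_localDefect_of_ne_zero`).
[cite: GreenbergLNM1716, §3] [cite: Rubin1999, §3 Lemma 3.6 (ii)] -/
theorem natCard_localDefect_le_two {w : HeightOneSpectrum (𝓞 K)} (hram : ¬ GreenbergSelmer.inertia w ≤ κ.kerSubgroup)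
    (hstab : ∀ m : M, IsOpen (MulAction.stabilizer (absoluteGaloisGroup K) m : Set (absoluteGaloisGroup K)))
    (hpm : ∀ g ∈ κ.kerSubgroup, (∀ m : M, g • m = m) ∨ (∀ m : M, g • m = -m))
    {τ₀ : absoluteGaloisGroup K} (hτI : τ₀ ∈ GreenbergSelmer.inertia w) (hτκ : τ₀ ∈ κ.kerSubgroup) (hτ₀ : ∀ m : M, τ₀ • m = -m)
    (h2 : ∀ x y : M, (2 : ℕ) • x = 0 → (2 : ℕ) • y = 0 → x ≠ 0 → y ≠ 0 → x = y) :
    Finite (resOfLe M (inf_le_inf_left κ.kerSubgroup (GreenbergSelmer.inertia_le_decomp w) :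
        κ.kerSubgroup ⊓ GreenbergSelmer.inertia w ≤ κ.kerSubgroup ⊓ GreenbergSelmer.decomp w)).ker ∧
      Nat.card (resOfLe M (inf_le_inf_left κ.kerSubgroup (GreenbergSelmer.inertia_le_decomp w) :
        κ.kerSubgroup ⊓ GreenbergSelmer.inertia w ≤ κ.kerSubgroup ⊓ GreenbergSelmer.decomp w)).ker ≤ 2 := by
  set D := (resOfLe M (inf_le_inf_left κ.kerSubgroup (GreenbergSelmer.inertia_le_decomp w) :
        κ.kerSubgroup ⊓ GreenbergSelmer.inertia w ≤ κ.kerSubgroup ⊓ GreenbergSelmer.decomp w)).ker with hD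
  have hpair : ∀ z z' : ↥D, z ≠ 0 → z' ≠ 0 → z = z' := by
    intro z z' hz0 hz'0
    apply Subtype.ext
    exact eq_of_mem_localDefect_of_ne_zero κ hram hstab hpm hτI hτκ hτ₀ h2
      ((AddMonoidHom.mem_ker).mp z.2) ((AddMonoidHom.mem_ker).mp z'.2)
      (fun h ↦ hz0 (Subtype.ext h)) (fun h ↦ hz'0 (Subtype.ext h))
  -- `D ⊆ {0, z₀}`: inject into `Bool`
  by_cases hex : ∃ z : ↥D, z ≠ 0
  · obtain ⟨z₀, hz₀⟩ := hex
    let ι : ↥D → Bool := fun z ↦ if z = 0 then false else true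
    have hι : Function.Injective ι := by
      intro a b hab
      by_cases ha : a = 0 <;> by_cases hb : b = 0
      · rw [ha, hb]
      · simp [ι, ha, hb] at hab
      · simp [ι, ha, hb] at hab
      · exact hpair a b ha hb
    haveI : Finite ↥D := Finite.of_injective ι hι
    exact ⟨inferInstance, by simpa using Nat.card_le_card_of_injective ι hι⟩
  · push Not at hex
    haveI : Subsingleton ↥D := ⟨fun a b ↦ by rw [hex a, hex b]⟩
    haveI : Finite ↥D := Finite.of_subsingleton
    exact ⟨inferInstance, (Finite.card_le_one_iff_subsingleton.mpr inferInstance).trans one_le_two⟩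

end Summit.BirchSwinnertonDyer.BirchSwinnertonDyer.Theorems.PrintCf2.LineLocallyTrivial

end
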